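import Literature.MathematicalPhysics.QuantumFieldTheory.BalabanImbrieJaffe1984to88.BIJ88Eq596BySteps

/-!
# `BalabanImbrieJaffe1984to88.BIJ88Eq596NonVacuity` — T. Bałaban, J. Imbrie, A. Jaffe, *Effective action and cluster properties of the abelian
Higgs model*, Commun. Math. Phys. **114** (1988) 257–315 [BalabanImbrieJaffe1988], (5.9.6) p. 297 [PDF 41] — **A KERNEL NON-VACUITY
CERTIFICATE FOR THE HEAD THEOREM `BIJ88Eq596BySteps.eq596_bySteps` OF ROW C2.Eq5.9.6**: a closed instance, for EVERY torus `P` of the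
standing range (`d ≥ 2`), every step `k` (`k + 1 ≤ m + K`) and every `a > 0`, in which ALL ~40 hypotheses of `eq596_bySteps` — the standing
data, the p02 dictionary `Laws`, the p13 regularity, the (4.16)-clauses on the slots, the readings, the (5.2.8) input — are DISCHARGED by the
kernel for explicit toy data with every binder inhabited.

statement-level skeleton of published theorems with citation tags; proofs where landed; nothing here is a claim about the Yang–Mills mass gap

WHY (owner r16's follow-up ask on the flip of C2.Eq5.9.6, ROWS-C2-part2 v2.166: *"a kernel NON-VACUITY CERTIFICATE — a closed toy instance of
`eq596_bySteps` … showing the hypothesis family jointly satisfiable with every binder inhabited; if some reading/(4.16)-clause pair turns out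
contradictory the head returns to typed"*).  The hypotheses of `eq596_bySteps` that are READINGS (`hread`, `hQread`, `hPread`, `hreadS`,
`hZread`, `hZv`) and (4.16)-CLAUSES (`hQcov`, `hΔ`, `hPinv`, `hZaway`) are universally quantified over ALL axial-gauge configurations (not
only over the support of the bracket), as are the `Laws`; this file shows they are simultaneously satisfiable together with the measure-level
input (5.2.8), by exhibiting data and kernel proofs.

THE TOY DATA (§1).  One term (`ι = Unit`), hole/observable index types `PUnit`, Gaussian index types `Fin 1`, carriers `ℝ`:
* the (4.1) term `toyT`: `χ_k = g_k = F_{k,loc} = 1`, `Z^{(j)}_v = 1`, `Z^{(j)}(u) = Zloc(1) 1` (p13's Gaussian normalization of the constant `1 × 1`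
  family), `e_k = 1`, `Λ₅ = ∅`, `σ_{k,loc} = 0`, `Λ₈ = T₁^{(k)}` (all sites), **`Δ_{k,loc}(u; x, y) = δ_{xy}`** (the identity kernel — gauge COVARIANT,
  so the (4.16)-clause `hΔ` is a genuine instance of the mechanism: `Σ|e^{iλ}φ|² = Σ|φ|²`), `𝒫_{k,loc} = 0`, `ℰ_k = 0`, `u_k ≡ 1`; hence
  `ρ′_t = Zloc(1)1^k · exp(−½Σ_x|φ(x)|²)` — a bona fide Gaussian;
* the weight `w ≡ 1` (so the support of `ζχ·χ_k` is everything and NO hypothesis holds vacuously), `Q(u_k)φ = φ ∘ emb` (the tree's lattice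
  embedding `T^{(k+1)} ⊂ T^{(k)}`), `a > 0` arbitrary;
* the (5.2.8) output `ρ̃^L_{k+1} := BIJ88Eq596Exists.rdg …` — gen 10's CONSTRUCTED density (sum of Radon–Nikodym densities of the push-forwards),
  so that the input K5 `h528` is gen 10's `isRDG_rdg_axial` BY NAME, fed by the ONE analytic fact of this file, the integrability `toy_integrable`
  (gen 9's `integrable_gauss_mul_of_integrable` — unit `dψ`-mass of the Gaussian — over the product Gaussian in `φ`, Mathlib's
  `GaussianFourier.integral_rexp_neg_mul_sq_norm` per site and `Integrable.fintype_prod`);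
* p02's §5.5/§5.8 dictionaries with ALL operators `0` (`L = 1`, `a = a_k = 0`) — their `Laws` hold (`gOps_laws`, `sOps_laws`); the rotation data
  `e_k = η = 1`, `λ ≡ 1` on all three lattices (non-trivial constant phases `e^{i}`), `Q(u_k)` and `𝒫_{k,loc}` as functions of the background
  (`φ ∘ emb`, `0`); the Sect. 5.6 family `F(e′) :=` the (5.8.1)-read forms (constant in `e′`), `n̄ = 0`, `δR = 0`; the Sect. 5.7 families
  `M_j(e′) = 1`; the (5.9.6) table `D = 0`; `Λ = ∅`, `s ≡ 1`, the p. 282 phases `≡ 1`, `c = 0`, `χ_ins ≡ 1`, `S_t = univ`, `λ_Z ≡ 1`.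

WHAT IS PROVED (§2–§3; 0 `sorry`, standard axioms, NO `Prop`-valued fact).  `toy_scalarForm` (`⟨φ, Δφ⟩ = Σ_x|φ(x)|²`), `toy_gaugeForm` (`= 0`),
`toy_rhoPrime` (the Gaussian form of `ρ′`), the private kernels `integrable_cgauss_site`/`integrable_toyG` (the `φ`-Gaussian is `dφ`-integrable), **`toy_integrable`**
(hypothesis `hρi`), **`toy_isRD`** (hypothesis `h528` = (5.2.8) for the toy bracket with gen 10's constructed density), `gOps_laws`, `sOps_laws`, and
**`eq596_bySteps_nonvacuous`**: the conclusion of `eq596_bySteps` for the toy data, obtained by applying `eq596_bySteps` with every hypothesis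
discharged — (G) `hread` (both sides `0`), (S) `hQread`/`hPread` (rfl), `hQcov` (rfl: constant phases commute with `∘ emb`), `hΔ` (identity
kernel), `hPinv`, `hreadS`, (Z) `hZv`/`hZaway`/`hZread` (rfl), `hM` (`Matrix.PosDef.one`), `hC` (constants are smooth), `Laws`, (C) `hins`
(`χ_ins ≡ 1`), the frame data (`hmφ`, `hmψ`, `hs`, `hsupp`, `hQS`).

HONEST SCOPE.  A satisfiability certificate, nothing more: the toy data are NOT the paper's objects (zero dictionaries, identity `Δ_{k,loc}`,
trivial regions); it certifies that the hypothesis family of the head theorem is consistent and every binder is inhabited, for all `P`, `k`, `a`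
of the standing range.  It does not exercise the companion `eq596_bySteps_ins`: its `InsertionReading` carries r16's `CutoffProfile` (the
(5.2.3) profile `χ(1, ·)`, a Gevrey-class bump function) — that certificate is the sequel `BIJ88Eq596InsNonVacuity.eq596_bySteps_ins_nonvacuous`
(this seat, gen 14), which fills the profile slot with p36's CONSTRUCTED inhabitant `BIJ88CutoffProfileWitness.gevreyCutoff` and discharges the five
printed bounds (5.9.1)–(5.9.5) on a small-field support.  Imports this seat's `BIJ88Eq596BySteps` only (Literature + Mathlib).  Seat p34 gen 13
(unit `lit-balaban-p34-g13`; TAKING line HOME/STATUS.md 2026-08-22T12:11:44Z).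
v1.1 (gen 14, unit `lit-balaban-p34-g14`): DOCFIX only — the v1.0 sentence *"of which the tree holds no inhabitant — a closed instance of
`eq596_bySteps_ins` is exactly as far away as a construction of that profile"* was out of date when written (p36 g7's `gevreyCutoff`, row
C2.Eq5.2.1-5.2.4, inhabits `CutoffProfile`) and is replaced by the pointer above; no declaration added, removed or re-typed.
-/

open scoped RealInnerProductSpace

namespace Literature.MathematicalPhysics.QuantumFieldTheory.BalabanImbrieJaffe1984to88.BIJ88Eq596NonVacuity

open Literature.MathematicalPhysics.QuantumFieldTheory.Balaban1983to89
open BIJ88Sect3Statements (U1 cfg)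
open BIJ85Sect1Model (HiggsField)
open BIJ88Sect4Statements (bgGaugeU bgGaugePhi)
open BIJ88RenormTransf311 (axialMeasure axialBonds gaussWeight DeltaAx)
open BIJ88InductiveForm41 (Prev prevMeasure Term41 rhoPrime gaugeForm scalarForm)
open BIJ85BlockAveragesTorus (qU)
open BIJ88RT52Restrictions (Fields fieldsMeasure IsRD integrable_gauss_mul_of_integrable)
open BIJ88Eq596Display (uCut IsDT isRD_iff_isRDG)
open BIJ88Eq596Exists (rdg isRDG_rdg_axial)
open BIJ88RT552Transl (bondMul)
open BIJ88Eq596Frame (Entry Bracket596 bracket596)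
open BIJ88Eq596Density (rho596 renamedBracket)
open BIJ88Eq596Sectors (uOrig phiOrig psiOrig rho528 gaussQuad fill41)
open BIJ88Eq596SlotsByName (GaugeReading ScalarReading ExpansionReading ZReading gLHS rfk sMid2)
open BIJ88Eq596BySteps (RotationReading ukRot phiRot psiRot sMid1 fillSteps eq596_bySteps norm_exp_I_mul_real)
open BIJ88PertQ5715 (Zloc)
open scoped BigOperators
open _root_.MeasureTheory Complex

noncomputable section

variable (P : Params) (k : ℕ)

/-! ## §1 The toy data -/

/-- p02's §5.5 gauge dictionary on the carrier `ℝ` with every operator `0` (`L = 1`). [cite: BalabanImbrieJaffe1988, (5.5.12) p.285] -/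
def gOps : BIJ88GaugeSummary5512.Ops ℝ :=
  { L := 1, σloc := 0, σ := 0, d := 0, ds := 0, Λ1 := 0, Λ2 := 0, box := 0, Λ4 := 0, Λ5 := 0, Cloc := 0, Hsloc := 0, X := 0, Kst := 0,
    Qes := 0, Qe1 := 0, Qe := 0, dη := 0, Hk := 0, Hloc := 0,
    Qesk := 0, Qesk1 := 0, Qek1 := 0, dηs := 0, Dloc := 0, Dk := 0, Dnext := 0, σL := 0, Λ5p := 0, Λ2ss := 0 }

/-- the zero dictionary obeys p02's `Laws` (every law is `0 = 0`). [cite: BalabanImbrieJaffe1988, (5.5.12) p.285] -/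
theorem gOps_laws : (gOps).Laws := by
  constructor
  · constructor <;> intros <;> simp [gOps, BIJ88Sect5StatementsPart3.Eq551]
  all_goals intros; simp [gOps]

/-- p02's §5.8 scalar dictionary on the carriers `ℝ, ℝ, ℝ` with every operator `0` (`a = a_k = 0`). [cite: BalabanImbrieJaffe1988, (5.8.3) p.296] -/
def sOps : BIJ88ScalarSummary583.Ops ℝ ℝ ℝ :=
  { a := 0, ak := 0, Λ8 := 0, Δ := 0, P := 0, Λ7 := 0, C := 0, Cloc := 0, Q := 0, Qst := 0, Tst := 0, Λ8' := 0, Q1 := 0, Q1st := 0,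
    G := 0, Gloc := 0 }

/-- the zero dictionary obeys p02's `Laws`. [cite: BalabanImbrieJaffe1988, (5.8.3) p.296] -/
theorem sOps_laws : (sOps).Laws := by
  constructor <;> intros <;> simp [sOps, BIJ88ScalarSummary583.Ops.T]

/-- the constant `1 × 1` Gaussian family of Sect. 5.7. [cite: BalabanImbrieJaffe1988, (5.7.13) p.295] -/
def oneFam : ℝ → Matrix (Fin 1) (Fin 1) ℝ := fun _ => 1

/-- **The toy (4.1) term**: `χ_k = g_k = F_{k,loc} = 1`, `Z_v = 1`, `Z(u) = Zloc(1) 1`, `e_k = 1`, `Λ₅ = ∅`, `σ_{k,loc} = 0`, `Λ₈ =` all sites,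
`Δ_{k,loc}(u; x, y) = δ_{xy}`, `𝒫_{k,loc} = 0`, `ℰ_k = 0`, `u_k ≡ 1`. [cite: BalabanImbrieJaffe1988, (4.1) p.273] -/
def toyT : Term41 P k where
  Ω := PUnit
  Obs := PUnit
  g := fun _ _ _ _ => 1
  Floc := fun _ _ _ _ => 1
  chi := fun _ _ _ => 1
  uk := fun _ _ _ => 1
  Zv := fun _ => 1
  Zs := fun _ _ => Zloc oneFam 1
  ek := 1
  Λ5 := ∅
  σloc := fun _ _ => 0
  Λ8 := Finset.univ
  Δloc := fun _ x y => if x = y then 1 else 0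
  Ploc := fun _ _ _ => 0
  calE := 0

/-- the toy (5.9.6) table: every entry `0` (the assembly overwrites what it feeds). [cite: BalabanImbrieJaffe1988, (5.9.6) p.297] -/
def toyD : Bracket596 P k Unit :=
  ⟨0, 0, 0, 0, 0, 0, 0, 0, 0, 0, 0, 0, 0, 0, 0, 0, 0, 0, 0, 0, 0, 0, 0, 0, 0⟩

/-- the toy gauge reading: zero dictionary, zero readings. [cite: BalabanImbrieJaffe1988, (5.3.2) p.280] -/
def toyRG : GaugeReading P k Unit ℝ := ⟨fun _ => gOps, fun _ _ _ _ => 0, fun _ _ _ _ => 0, fun _ _ _ _ => 0⟩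

/-- the toy scalar reading: zero dictionary, zero readings. [cite: BalabanImbrieJaffe1988, (5.8.1) p.295] -/
def toyRS : ScalarReading P k Unit ℝ ℝ ℝ := ⟨fun _ _ _ _ => sOps, fun _ _ _ _ _ => 0, fun _ _ _ _ _ => 0⟩

/-- the toy Sect. 5.7 reading: the constant families `M_j ≡ 1`, `Z_v = 1`, `n̄ = 0`. [cite: BalabanImbrieJaffe1988, (5.7.13) p.295] -/
def toyRZ : ZReading P k Unit (fun _ => Fin 1) := ⟨fun _ _ _ _ _ => oneFam, fun _ _ => 1, 0⟩

/-- the toy rotation reading: `e_k = η = 1`, `λ ≡ 1` on `T_η`, `T₁^{(k)}`, `T^{(k+1)}`; `Q(u_k)φ = φ ∘ emb`; `𝒫_{k,loc} = 0`.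
[cite: BalabanImbrieJaffe1988, (5.4.5) p.282] -/
def toyR : RotationReading P k Unit :=
  { ek := 1, η := 1, lam0 := fun _ _ _ _ _ => 1, lamk := fun _ _ _ _ _ => 1, lamL := fun _ _ _ _ _ => 1,
    QB := fun _ _ _ φ y => φ (emb y), PB := fun _ _ _ _ => 0 }

/-- the toy `Q`-slot of the (5.2.8) frame: `Q(u_k)φ = φ ∘ emb`. [cite: BalabanImbrieJaffe1988, (5.1.4) p.278] -/
def toyQφ : Unit → Prev P k → GaugeField P k U1 → HiggsField P k → HiggsField P (k+1) := fun _ _ _ φ y => φ (emb y)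

/-- the toy weight `ζχ ≡ 1`. [cite: BalabanImbrieJaffe1988, (5.2.7) p.279] -/
def toyw : Unit → Prev P k → GaugeField P k U1 → HiggsField P k → HiggsField P (k+1) → ℝ := fun _ _ _ _ _ => 1

/-- the `φ`-Gaussian `exp(−½Σ_x|φ(x)|²)` (as a complex number). [cite: BalabanImbrieJaffe1988, (4.1) p.273] -/
def toyG (φ : HiggsField P k) : ℂ := ((Real.exp (-(1 / 2) * ∑ x, ‖φ x‖ ^ 2) : ℝ) : ℂ)

/-- the constant `Π_{j<k}[1 · Zloc(1) 1]`. [cite: BalabanImbrieJaffe1988, (4.1) p.273] -/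
def toyC : ℝ := ∏ _j : Fin k, (1 : ℝ) * Zloc oneFam 1

/-! ## §2 The toy term is a Gaussian; integrability; (5.2.8) by gen 10's construction -/

variable {P k}

/-- `⟨φ, Δ_{k,loc}φ⟩ = Σ_x|φ(x)|²` for the identity kernel on all sites. [cite: BalabanImbrieJaffe1988, (4.1) p.273] -/
theorem toy_scalarForm (u : PBond P 0 → ℂ) (φ : HiggsField P k) : scalarForm (toyT P k) u φ = ∑ x, ‖φ x‖ ^ 2 := by
  unfold scalarForm
  simp only [toyT, mul_ite, mul_one, mul_zero, ite_mul, zero_mul, Finset.sum_ite_eq, Finset.mem_univ, if_true]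
  rw [Complex.re_sum]
  refine Finset.sum_congr rfl fun x _ => ?_
  rw [Complex.conj_mul', ← Complex.ofReal_pow, Complex.ofReal_re]

/-- `⟨f, σf⟩ = 0` for `Λ₅ = ∅`. [cite: BalabanImbrieJaffe1988, (4.1) p.273] -/
theorem toy_gaugeForm (u : PBond P k → ℂ) : gaugeForm (toyT P k) u = 0 := by
  unfold gaugeForm
  simp [toyT]

/-- **the toy `ρ′` is the Gaussian** `Π_j[1·Zloc(1)1] · exp(−½Σ_x|φ(x)|²)`. [cite: BalabanImbrieJaffe1988, (4.1) p.273] -/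
theorem toy_rhoPrime (prev : Prev P k) (u : PBond P k → ℂ) (φ : HiggsField P k) :
    rhoPrime (toyT P k) prev u φ = (toyC k : ℂ) * toyG P k φ := by
  have hS := toy_scalarForm (k := k) ((toyT P k).uk prev u) φ
  have hG := toy_gaugeForm (k := k) u
  unfold rhoPrime
  rw [hS, hG]
  simp only [toyT, toyC, toyG, Finset.prod_const_one, one_mul, mul_one, mul_zero, sub_zero, zero_sub, Complex.ofReal_mul]
  congr 2
  ring

/-- the one-site complex Gaussian `e^{−½|z|²}` is `d²z`-integrable (its integral is `2π ≠ 0`). [folklore] -/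
private theorem integrable_cgauss_site : Integrable (fun z : ℂ => Real.exp (-(1 / 2) * ‖z‖ ^ 2)) := by
  refine Integrable.of_integral_ne_zero ?_
  rw [GaussianFourier.integral_rexp_neg_mul_sq_norm (by norm_num : (0 : ℝ) < 1 / 2)]
  positivity

/-- the `φ`-Gaussian is `𝒟φ`-integrable (product of one-site Gaussians). [folklore] -/
private theorem integrable_toyG : Integrable (toyG P k) := by
  have h1 : Integrable (fun φ : HiggsField P k => ∏ x, Real.exp (-(1 / 2) * ‖φ x‖ ^ 2)) :=
    Integrable.fintype_prod (f := fun (_ : Balaban1983to89.Site P k) (z : ℂ) => Real.exp (-(1 / 2) * ‖z‖ ^ 2))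
      fun _ => integrable_cgauss_site
  have h2 : toyG P k = fun φ => ((∏ x, Real.exp (-(1 / 2) * ‖φ x‖ ^ 2) : ℝ) : ℂ) := by
    funext φ
    rw [toyG, Finset.mul_sum, Real.exp_sum]
  rw [h2]
  exact h1.ofReal

/-- **hypothesis `hρi` of `eq596_bySteps` for the toy data**: the bracket `1 · ρ′ · gaussWeight_a(φ ∘ emb, ψ)` is integrable on the configurations
of the term (gen 9's `integrable_gauss_mul_of_integrable`: the `ψ`-Gaussian has unit mass, `a > 0`, `d ≥ 2`). [cite: BalabanImbrieJaffe1988, (5.2.8) p.279] -/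
theorem toy_integrable {a : ℝ} (ha : 0 < a) (hd : 2 ≤ P.d) (t : Unit) :
    Integrable (fun q : Fields P k => rho528 (toyw P k) (fun _ => toyT P k) t q.2.1 q.1 q.2.2.1 q.2.2.2 *
      (gaussWeight a (toyQφ P k t q.2.1 q.1 q.2.2.1) q.2.2.2 : ℂ)) (fieldsMeasure (axialMeasure P k U1)) := by
  have hQ : Measurable fun p : Prev P k × (GaugeField P k U1 × HiggsField P k) => toyQφ P k t p.1 p.2.1 p.2.2 :=
    measurable_pi_lambda _ fun y => (measurable_pi_apply (emb y)).comp (measurable_snd.comp measurable_snd)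
  have hGm : Measurable (toyG P k) := by
    refine Complex.measurable_ofReal.comp (Real.measurable_exp.comp (Measurable.const_mul ?_ _))
    exact Finset.measurable_sum _ fun x _ => ((measurable_pi_apply x).norm).pow_const _
  have hρ_eq : (fun p : Prev P k × (GaugeField P k U1 × HiggsField P k) =>
      ((1 : ℝ) : ℂ) * rhoPrime (toyT P k) p.1 (cfg p.2.1) p.2.2) = fun p => (toyC k : ℂ) * toyG P k p.2.2 := by
    funext p
    rw [toy_rhoPrime, Complex.ofReal_one, one_mul]
  have hρm : Measurable fun p : Prev P k × (GaugeField P k U1 × HiggsField P k) =>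
      ((1 : ℝ) : ℂ) * rhoPrime (toyT P k) p.1 (cfg p.2.1) p.2.2 := by
    rw [hρ_eq]
    exact (hGm.comp (measurable_snd.comp measurable_snd)).const_mul _
  have hρi : Integrable (fun q : GaugeField P k U1 × (Prev P k × HiggsField P k) =>
      ((1 : ℝ) : ℂ) * rhoPrime (toyT P k) q.2.1 (cfg q.1) q.2.2)
      ((axialMeasure P k U1).prod ((prevMeasure P k).prod volume)) := by
    have h := (integrable_const (1 : ℂ) (μ := axialMeasure P k U1)).mul_prod
      ((integrable_const (1 : ℂ) (μ := prevMeasure P k)).mul_prod ((integrable_toyG (P := P) (k := k)).const_mul (toyC k : ℂ)))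
    refine h.congr (ae_of_all _ fun q => ?_)
    show (1 : ℂ) * ((1 : ℂ) * ((toyC k : ℂ) * toyG P k q.2.2)) = ((1 : ℝ) : ℂ) * rhoPrime (toyT P k) q.2.1 (cfg q.1) q.2.2
    rw [toy_rhoPrime, Complex.ofReal_one, one_mul, one_mul]
  exact integrable_gauss_mul_of_integrable (Qφ₀ := toyQφ P k t)
    (ρ₀ := fun prev U φ => ((1 : ℝ) : ℂ) * rhoPrime (toyT P k) prev (cfg U) φ) ha hd hQ hρm hρi

/-- **hypothesis `h528` of `eq596_bySteps` for the toy data — (5.2.8) BY NAME**: gen 10's constructed density `rdg` of the toy bracket satisfies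
the display (5.2.8) over `𝒟u δ_{Ax}` (`isRDG_rdg_axial`, standing range). [cite: BalabanImbrieJaffe1988, (5.2.8) p.279] -/
theorem toy_isRD (hk : k + 1 ≤ P.m + P.K) {a : ℝ} (ha : 0 < a) (hd : 2 ≤ P.d) :
    IsRD (axialMeasure P k U1) {()} qU (toyQφ P k) a (rho528 (toyw P k) (fun _ => toyT P k))
      (rdg (axialMeasure P k U1) {()} qU fun t prev U φ ψ =>
        rho528 (toyw P k) (fun _ => toyT P k) t prev U φ ψ * (gaussWeight a (toyQφ P k t prev U φ) ψ : ℂ)) :=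
  (isRD_iff_isRDG _ _ _ _).2 (isRDG_rdg_axial hk fun t _ => toy_integrable ha hd t)

/-! ## §3 The certificate -/

/-- **KERNEL NON-VACUITY CERTIFICATE FOR `eq596_bySteps`.**  For every torus `P` with `d ≥ 2`, every step `k` of the standing range and every
`a > 0`, the conclusion of `BIJ88Eq596BySteps.eq596_bySteps` holds for the toy data of §1 — obtained by APPLYING `eq596_bySteps` with all of its
hypotheses discharged by the kernel: the (5.2.8) input (`toy_isRD`, gen 10's construction), integrability (`toy_integrable`), the frame data,
p02's `Laws` (`gOps_laws`, `sOps_laws`), p13's regularity (`Matrix.PosDef.one`, constants), the (4.16)-clauses `hQcov`/`hΔ`/`hPinv`/`hZaway` and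
the readings `hread`/`hQread`/`hPread`/`hreadS`/`hZread`/`hZv` (identity kernel, constant phases, zero dictionaries), (C) `hins` (`χ_ins ≡ 1`).
Every binder is inhabited (one term; `Ω = Obs = PUnit`; `n_Z = Fin 1`; carriers `ℝ`; weight `≡ 1`, so no premise is empty).
[cite: BalabanImbrieJaffe1988, (5.9.6) p.297] -/
theorem eq596_bySteps_nonvacuous (hk : k + 1 ≤ P.m + P.K) {a : ℝ} (ha : 0 < a) (hd : 2 ≤ P.d) :
    IsDT (axialMeasure P k U1) {()} (fun _ => ∅) qU
        (bracket596 (fill41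
          (fillSteps (toyD P k) (toyRG P k) (toyRS P k)
            ⟨sMid1 (toyR P k) (fun _ => toyT P k) a (fun _ => ∅) (fun _ _ => 1) (fun _ _ _ _ _ => 1) (fun _ _ _ _ _ => 1) (fun _ _ _ _ _ => 0),
              fun t prev u' v φ ψ _ => sMid2 (toyRS P k) t prev u' v φ ψ, 0, 0⟩ (toyRZ P k))
          (fun _ => toyT P k) (toyw P k) a (fun _ => ∅) (fun _ _ => 1) (fun _ _ _ _ _ => 1) (fun _ _ _ _ _ => 1) (fun _ _ _ _ _ => 0)
          (fun _ _ _ _ _ _ => 1)))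
        (rho596 {()} (fun _ => ∅) (renamedBracket (toyQφ P k) a (rho528 (toyw P k) (fun _ => toyT P k)) (fun _ => ∅)
          (fun _ _ _ _ _ => 1) (fun _ _ _ _ _ => 1))) ∧
      ∫ v, ∫ ψ, rho596 {()} (fun _ => ∅) (renamedBracket (toyQφ P k) a (rho528 (toyw P k) (fun _ => toyT P k)) (fun _ => ∅)
          (fun _ _ _ _ _ => 1) (fun _ _ _ _ _ => 1)) v ψ ∂volume ∂fieldMeasure P (k+1) U1 =
        ∫ v, ∫ ψ, rdg (axialMeasure P k U1) {()} qU (fun t prev U φ ψ =>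
          rho528 (toyw P k) (fun _ => toyT P k) t prev U φ ψ * (gaussWeight a (toyQφ P k t prev U φ) ψ : ℂ)) v ψ
          ∂volume ∂fieldMeasure P (k+1) U1 := by
  refine eq596_bySteps (toyD P k) (fun _ => toyT P k) a (toyQφ P k) (fun _ => ∅) (fun _ _ => 1) (fun _ _ _ _ _ => 1) (fun _ _ _ _ _ => 1)
    (fun _ _ _ _ _ => 0) (toyRG P k) (toyRS P k) (toyRZ P k) (toyw P k) hk (toy_isRD hk ha hd) (fun t _ => toy_integrable ha hd t)
    (fun _ _ => measurable_const) (fun _ _ => measurable_const) (fun _ _ _ _ _ => rfl) (fun _ => Set.univ)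
    (fun _ _ _ _ _ _ _ _ => Set.mem_univ _) (fun t _ u' _ w => ?_) (fun _ _ _ _ _ _ => 1) (fun _ _ _ _ _ _ _ _ _ => rfl)
    (fun _ _ => gOps_laws) (fun t _ prev u' v _ => ?_) (toyR P k) (fun _ _ _ _ _ _ _ _ => rfl) (fun _ _ _ _ _ _ _ _ => rfl)
    (fun t _ prev u' v φ ψ _ => ?_) (fun _ _ _ _ _ _ _ _ => rfl) (fun _ _ _ _ _ _ _ _ => rfl)
    (fun t prev u' v φ ψ _ => sMid2 (toyRS P k) t prev u' v φ ψ) 0 0 (fun _ _ _ _ _ => sOps_laws) (fun t _ prev u' v φ ψ _ => ?_)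
    1 1 (fun _ _ _ _ _ => 1) (fun _ _ _ => rfl) (fun _ _ _ _ _ _ _ => rfl) (fun _ _ _ _ _ _ _ => rfl)
    (fun _ _ _ _ _ _ _ _ => Matrix.PosDef.one) (fun _ _ _ _ _ _ _ _ => contDiffOn_const)
  · -- hQS: the toy shift `s ≡ 1` does not move `u′`
    have hb : ∀ b, (1 : GaugeField P k U1) b = 1 := fun _ => rfl
    have h1 : bondMul u' (1 : GaugeField P k U1) = u' := by funext b; rw [BIJ88RT552Transl.bondMul_apply, hb, mul_one]
    have h2 : (bondMul u' fun b => ((1 : GaugeField P k U1) b)⁻¹) = u' := by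
      funext b; rw [BIJ88RT552Transl.bondMul_apply, hb, inv_one, mul_one]
    exact ⟨by rw [h1], by rw [h2]⟩
  · -- hread: both sides vanish (Λ₅ = ∅; Λ₅′** = 0 on the carrier)
    rw [toy_gaugeForm, mul_zero, gLHS]
    simp [toyRG, gOps]
  · -- hΔ: the identity kernel is gauge covariant — `Σ|e^{i}φ|² = Σ|φ|²`
    rw [toy_scalarForm, toy_scalarForm]
    refine Finset.sum_congr rfl fun x _ => ?_
    simp only [phiRot, bgGaugePhi, norm_mul, norm_exp_I_mul_real, mul_one]
  · -- hreadS: `F(0)` = the read forms, `𝒫_{k,loc}`-entry `0`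
    simp [toyD]

end

end Literature.MathematicalPhysics.QuantumFieldTheory.BalabanImbrieJaffe1984to88.BIJ88Eq596NonVacuity
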